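import Summits.Ventures.YMGap.RobustBall.ZNGaugeGeometry
import Summits.Ventures.YMGap.RobustBall.FiniteHeatBathDobrushin
import Summits.Ventures.YMGap.RobustBall.FiniteGibbsInfluence
import HarnessLib

/-!
# RobustBall/ZNGaugeLayer — the `i`-link system of the induced inhomogeneous `ℤ_N` gauge theory given the
# transverse links: Dobrushin influences `≤ |β|A` per shared plaquette, row sums `≤ 2(d−1)|β|A`, layer
# `ℤ_N` symmetry, and the two-point bound `|E ψ(k_b − k_t)| ≤ 4 c^{dist_j(b,t)}`

HONEST FRAMING: venture file of the cell `pub-ymgap` (track Y2 ROBUST-BALL, seat ds-4 g7): finite sums on a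
finite torus (the `ℤ_N` side of the centre-projection area law, Durhuus–Fröhlich layer mechanism run on the
tree's measure-free Dobrushin comparison `Dobrushin.DustingData.abs_sub_le_sum_pow`).  No `SU(N)` measure here,
no area law yet (that is `ZNGaugePeeling` / `CentreBlindAreaLaw`); nothing about the continuum limit.

Setting: direction `i`, transverse values `kT` FROZEN, complex plaquette couplings `a p` with `‖a p‖ ≤ A`
(for the induced theory `a p = tr U_p`, `A = N`); the `i`-link system is the finite spin system
`kI : Site d L → ℤ/N` with weight `layerWeight = exp(β ∑_p Re(ψ((curl (glue kI kT))_p) · a p))`.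
* influences (`tv_layerWeight_le`): `tv ≤ |β| A · #{p reading both sites}` (`FiniteGibbsInfluence`);
  row sums `≤ 2(d−1)|β|A` (`rowsum_layerC_le`: each plaquette reads ≤ 2 `i`-links, ≤ 2(d−1) plaquettes per link);
* symmetry (`cavg_ψ_eval_eq_zero`): shifting every `i`-link by `1` preserves the weight, so one-point functions
  `E ψ(k_b)` vanish for `N ≥ 2`;
* **`norm_cavg_ψ_sub_le`**: for `c = 2(d−1)|β|A ≤ 1`, `‖E ψ(k_b − k_t)‖ ≤ 4 · c^{jDist j t b}` (condition on
  `k_t`, Dobrushin comparison with the `j`-distance profile, recombine with the vanishing one-point function).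
-/

noncomputable section

open Finset Function
open Literature.MathematicalPhysics.QuantumFieldTheory

namespace Summit.Ventures.YMGap.RobustBall

namespace ZN

variable {d L N : ℕ} [NeZero L] [NeZero N]

/-! ### The layer weight -/

/-- The plaquette term of the `i`-link system: `Re(ψ((curl (glue kI kT))_p) · a p)`. [folklore] -/
def phiP (i : Fin d) (kT : Transverse d L (ZMod N) i) (a : Plaquette d L → ℂ) (p : Plaquette d L)
    (kI : Site d L → ZMod N) : ℝ :=
  (ψ N (plaqSum (glue i kI kT) p.1 p.2.1.1 p.2.1.2) * a p).re

/-- The weight of the `i`-link system given the transverse links. [folklore] -/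
def layerWeight (i : Fin d) (kT : Transverse d L (ZMod N) i) (a : Plaquette d L → ℂ) (β : ℝ)
    (kI : Site d L → ZMod N) : ℝ :=
  Real.exp (β * ∑ p, phiP i kT a p kI)

/-- The layer weight is positive. [folklore] -/
theorem layerWeight_pos (i : Fin d) (kT : Transverse d L (ZMod N) i) (a : Plaquette d L → ℂ) (β : ℝ)
    (kI : Site d L → ZMod N) : 0 < layerWeight i kT a β kI := Real.exp_pos _

omit [NeZero L] in
/-- The plaquette term reads `kI` only on `iSites i p`. [folklore] -/
theorem dependsOn_phiP (i : Fin d) (kT : Transverse d L (ZMod N) i) (a : Plaquette d L → ℂ) (p : Plaquette d L) :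
    DependsOn (phiP i kT a p) (↑(iSites i p) : Set (Site d L)) := fun kI kI' h => by
  unfold phiP
  rw [plaqSum_glue_congr i kT p fun y hy => h y (Finset.mem_coe.2 hy)]

omit [NeZero L] in
/-- `|phiP| ≤ A` when `‖a p‖ ≤ A`. [folklore] -/
theorem abs_phiP_le (i : Fin d) (kT : Transverse d L (ZMod N) i) {a : Plaquette d L → ℂ} {A : ℝ}
    (hA : ∀ p, ‖a p‖ ≤ A) (p : Plaquette d L) (kI : Site d L → ZMod N) : |phiP i kT a p kI| ≤ A := by
  unfold phiP
  refine (Complex.abs_re_le_norm _).trans ?_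
  rw [norm_mul, norm_ψ, one_mul]
  exact hA p

/-! ### Dobrushin influences of the layer system -/

/-- The influence coefficient: `|β| A · #{p reading both i-sites y, y'}` (zero on the diagonal). [folklore] -/
def layerC (i : Fin d) (β A : ℝ) (y y' : Site d L) : ℝ :=
  if y' = y then 0 else |β| * A * (((Finset.univ : Finset (Plaquette d L)).filter
    fun p => y ∈ iSites i p ∧ y' ∈ iSites i p).card : ℝ)

/-- The neighbourhood: other `i`-sites sharing a plaquette. [folklore] -/
def layerNbr (i : Fin d) (y : Site d L) : Finset (Site d L) :=
  Finset.univ.filter fun y' => y' ≠ y ∧ ∃ p : Plaquette d L, y ∈ iSites i p ∧ y' ∈ iSites i p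

/-- Influence coefficients are nonnegative (for `A ≥ 0`). [folklore] -/
theorem layerC_nonneg (i : Fin d) (β : ℝ) {A : ℝ} (hA : 0 ≤ A) (y y' : Site d L) : 0 ≤ layerC i β A y y' := by
  unfold layerC; split_ifs
  · exact le_rfl
  · positivity

/-- Influence coefficients vanish off the neighbourhood. [folklore] -/
theorem layerC_eq_zero (i : Fin d) (β A : ℝ) (y y' : Site d L) (h : y' ∉ layerNbr i y) : layerC i β A y y' = 0 := by
  unfold layerC
  split_ifs with hy
  · rfl
  · rw [layerNbr, Finset.mem_filter, not_and] at h
    have hne : ¬∃ p : Plaquette d L, y ∈ iSites i p ∧ y' ∈ iSites i p := fun hex => h (Finset.mem_univ _) ⟨hy, hex⟩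
    have hempty : ((Finset.univ : Finset (Plaquette d L)).filter
        fun p => y ∈ iSites i p ∧ y' ∈ iSites i p) = ∅ :=
      Finset.filter_eq_empty_iff.2 fun p _ hp => hne ⟨p, hp⟩
    rw [hempty, Finset.card_empty, Nat.cast_zero, mul_zero]

/-- **One-site influences of the layer system**: `tv ≤ layerC` for environments differing at one other site. [folklore] -/
theorem tv_layerWeight_le (i : Fin d) (kT : Transverse d L (ZMod N) i) {a : Plaquette d L → ℂ} {A : ℝ}
    (hA : ∀ p, ‖a p‖ ≤ A) (β : ℝ) (y y' : Site d L) (hy : y' ≠ y) (σ τ : Site d L → ZMod N)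
    (hστ : ∀ z, z ≠ y' → σ z = τ z) :
    FiniteGibbs.tv (layerWeight i kT a β) y σ τ ≤ layerC i β A y y' := by
  rw [layerC, if_neg hy]
  exact FiniteGibbs.tv_le_of_exp_sum (iSites i) (phiP i kT a) (dependsOn_phiP i kT a) (abs_phiP_le i kT hA) β
    (fun _ => rfl) hστ

/-- **Row sums of the layer influences**: `∑_{y'} layerC y y' ≤ 2(d−1) |β| A`. [folklore] -/
theorem rowsum_layerC_le (i : Fin d) (β : ℝ) {A : ℝ} (hA : 0 ≤ A) (y : Site d L) :
    ∑ y' ∈ layerNbr i y, layerC i β A y y' ≤ 2 * ((d - 1 : ℕ) : ℝ) * |β| * A := by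
  classical
  -- bound by the sum over all `y' ≠ y`
  have h1 : ∑ y' ∈ layerNbr i y, layerC i β A y y' ≤ ∑ y' ∈ Finset.univ.erase y, layerC i β A y y' :=
    Finset.sum_le_sum_of_subset_of_nonneg (fun y' hy' => by
      rw [layerNbr, Finset.mem_filter] at hy'
      exact Finset.mem_erase.2 ⟨hy'.2.1, Finset.mem_univ _⟩) fun _ _ _ => layerC_nonneg i β hA _ _
  refine h1.trans ?_
  -- rewrite each coefficient as a sum of indicators over plaquettes and exchange the sums
  have h2 : ∀ y' ∈ Finset.univ.erase y, layerC i β A y y' =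
      |β| * A * ∑ p : Plaquette d L, (if y ∈ iSites i p ∧ y' ∈ iSites i p then (1 : ℝ) else 0) := by
    intro y' hy'
    rw [layerC, if_neg (Finset.mem_erase.1 hy').1, Finset.card_filter]
    push_cast
    rfl
  rw [Finset.sum_congr rfl h2, ← Finset.mul_sum, Finset.sum_comm]
  -- for each plaquette reading `y`, at most one other `i`-site is read
  have h3 : ∀ p : Plaquette d L, ∑ y' ∈ Finset.univ.erase y,
      (if y ∈ iSites i p ∧ y' ∈ iSites i p then (1 : ℝ) else 0) ≤ if y ∈ iSites i p then 1 else 0 := by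
    intro p
    split_ifs with hyp
    · have : ∑ y' ∈ Finset.univ.erase y, (if y ∈ iSites i p ∧ y' ∈ iSites i p then (1 : ℝ) else 0) =
          (((Finset.univ.erase y).filter fun y' => y' ∈ iSites i p).card : ℝ) := by
        rw [Finset.card_filter]; push_cast
        exact Finset.sum_congr rfl fun y' _ => by simp [hyp]
      rw [this]
      have hsub : (Finset.univ.erase y).filter (fun y' => y' ∈ iSites i p) ⊆ (iSites i p).erase y := by
        intro y' hy'
        rw [Finset.mem_filter, Finset.mem_erase] at hy'
        exact Finset.mem_erase.2 ⟨hy'.1.1, hy'.2⟩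
      have hcard : ((iSites i p).erase y).card ≤ 1 := by
        rw [Finset.card_erase_of_mem hyp]
        have := card_iSites_le i p
        omega
      exact_mod_cast (Finset.card_le_card hsub).trans hcard
    · simp [hyp]
  have h4 : ∑ p : Plaquette d L, ∑ y' ∈ Finset.univ.erase y,
      (if y ∈ iSites i p ∧ y' ∈ iSites i p then (1 : ℝ) else 0) ≤ (2 * (d - 1) : ℕ) := by
    refine (Finset.sum_le_sum fun p _ => h3 p).trans ?_
    rw [Finset.sum_boole]
    exact_mod_cast card_filter_mem_iSites_le i y
  calc |β| * A * ∑ p : Plaquette d L, ∑ y' ∈ Finset.univ.erase y,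
        (if y ∈ iSites i p ∧ y' ∈ iSites i p then (1 : ℝ) else 0)
      ≤ |β| * A * (2 * (d - 1) : ℕ) := mul_le_mul_of_nonneg_left h4 (mul_nonneg (abs_nonneg _) hA)
    _ = 2 * ((d - 1 : ℕ) : ℝ) * |β| * A := by push_cast; ring

/-- The `j`-distance profile is `1`-Lipschitz along the layer neighbourhoods. [folklore] -/
theorem jDist_le_of_mem_layerNbr (i j : Fin d) (t y : Site d L) {y' : Site d L} (hy' : y' ∈ layerNbr i y) :
    jDist j t y ≤ jDist j t y' + 1 := by
  rw [layerNbr, Finset.mem_filter] at hy'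
  obtain ⟨p, hp, hp'⟩ := hy'.2.2
  exact jDist_le_of_mem_iSites i j t p hp hp'

/-! ### Layer `ℤ_N` symmetry: one-point functions vanish -/

/-- Shifting every `i`-link by a constant preserves the layer weight. [folklore] -/
theorem layerWeight_add_const (i : Fin d) (kT : Transverse d L (ZMod N) i) (a : Plaquette d L → ℂ) (β : ℝ)
    (kI : Site d L → ZMod N) (c : ZMod N) :
    layerWeight i kT a β (kI + fun _ => c) = layerWeight i kT a β kI := by
  rw [show (kI + fun _ => c) = fun y => kI y + c from rfl]
  unfold layerWeight phiP
  simp only [plaqSum_glue_add_const]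

/-- **One-point functions of the layer system vanish** (`N ≥ 2`): `E ψ(k_b) = 0`. [folklore] -/
theorem cavg_ψ_eval_eq_zero (hN : 2 ≤ N) (i : Fin d) (kT : Transverse d L (ZMod N) i) (a : Plaquette d L → ℂ)
    (β : ℝ) (b : Site d L) :
    FiniteGibbs.cavg (layerWeight i kT a β) (fun kI => ψ N (kI b)) = 0 := by
  set w := layerWeight i kT a β with hw
  have hsum : ∑ kI : Site d L → ZMod N, (w kI : ℂ) * ψ N (kI b) =
      ψ N 1 * ∑ kI : Site d L → ZMod N, (w kI : ℂ) * ψ N (kI b) := by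
    -- reindex by the shift `kI ↦ kI + 1`
    have hre : ∑ kI : Site d L → ZMod N, (w kI : ℂ) * ψ N (kI b) =
        ∑ kI : Site d L → ZMod N, (w (kI + fun _ => (1 : ZMod N)) : ℂ) * ψ N (kI b + 1) := by
      refine (Fintype.sum_equiv (Equiv.addRight (fun _ : Site d L => (1 : ZMod N))) _ _ fun kI => ?_).symm
      simp only [Equiv.coe_addRight, Pi.add_apply]
    conv_lhs => rw [hre]
    rw [Finset.mul_sum]
    refine Finset.sum_congr rfl fun kI _ => ?_
    rw [hw, layerWeight_add_const, ψ_add]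
    ring
  have hz : (1 - ψ N 1) * ∑ kI : Site d L → ZMod N, (w kI : ℂ) * ψ N (kI b) = 0 := by
    rw [sub_mul, one_mul, ← hsum, sub_self]
  rcases mul_eq_zero.1 hz with h | h
  · exact absurd (sub_eq_zero.1 h).symm (ψ_one_ne_one hN)
  · rw [FiniteGibbs.cavg, h, zero_div]

/-! ### The two-point bound -/

/-- **Two-point functions of the layer system** (`N ≥ 2`, `c = 2(d−1)|β|A ≤ 1`): for `i`-sites `b, t`,
`‖E ψ(k_b − k_t)‖ ≤ 4 · c^{jDist j t b}` — condition on `k_t` (Dobrushin comparison in the `j`-distance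
profile, oscillation `2` for `Re ψ`, `Im ψ`) and use `E ψ(k_b) = 0`. [folklore] -/
theorem norm_cavg_ψ_sub_le (hN : 2 ≤ N) (i j : Fin d) (kT : Transverse d L (ZMod N) i)
    {a : Plaquette d L → ℂ} {A : ℝ} (hA0 : 0 ≤ A) (hA : ∀ p, ‖a p‖ ≤ A) (β : ℝ) {c : ℝ}
    (hc : 2 * ((d - 1 : ℕ) : ℝ) * |β| * A ≤ c) (hc1 : c ≤ 1) (b t : Site d L) :
    ‖FiniteGibbs.cavg (layerWeight i kT a β) (fun kI => ψ N (kI b - kI t))‖ ≤ 4 * c ^ jDist j t b := by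
  classical
  set w := layerWeight i kT a β with hw
  have hwpos : ∀ kI, 0 < w kI := layerWeight_pos i kT a β
  have hc0 : 0 ≤ c := le_trans (by positivity) hc
  -- Dobrushin comparison for the real observables `Re ψ(k_b)`, `Im ψ(k_b)`
  have hcomp : ∀ (φ : ZMod N → ℝ), (∀ s s', |φ s - φ s'| ≤ 2) → ∀ s₀ : ZMod N,
      |FiniteGibbs.avg w (fun kI => φ (kI b)) - FiniteGibbs.avg (FiniteGibbs.fiber w t s₀) (fun kI => φ (kI b))| ≤
        c ^ jDist j t b * 2 := by
    intro φ hφ s₀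
    exact FiniteGibbs.abs_avg_sub_avg_fiber_le hwpos (C := layerC i β A) (nbr := layerNbr i)
      (fun y y' => layerC_nonneg i β hA0 y y') (fun y y' h => layerC_eq_zero i β A y y' h)
      (fun y y' hy σ τ hστ => tv_layerWeight_le i kT hA β y y' hy σ τ hστ) hc0 hc1
      (fun y => (rowsum_layerC_le i β hA0 y).trans hc) t (jDist j t) (jDist_self j t)
      (fun y _ y' hy' => jDist_le_of_mem_layerNbr i j t y hy') s₀ b φ hφ
  have hosc_re : ∀ s s' : ZMod N, |(ψ N s).re - (ψ N s').re| ≤ 2 := fun s s' => by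
    rw [← Complex.sub_re]
    refine (Complex.abs_re_le_norm _).trans ((norm_sub_le _ _).trans ?_)
    rw [norm_ψ, norm_ψ]; norm_num
  have hosc_im : ∀ s s' : ZMod N, |(ψ N s).im - (ψ N s').im| ≤ 2 := fun s s' => by
    rw [← Complex.sub_im]
    refine (Complex.abs_im_le_norm _).trans ((norm_sub_le _ _).trans ?_)
    rw [norm_ψ, norm_ψ]; norm_num
  -- the conditioned averages of `ψ(k_b)` are within `4 c^ℓ` of the unconditioned one
  have hB : ∀ s₀ : ZMod N, 0 < FiniteGibbs.mass (FiniteGibbs.fiber w t s₀) →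
      ‖FiniteGibbs.cavg (FiniteGibbs.fiber w t s₀) (fun kI => ψ N (kI b)) -
        FiniteGibbs.cavg w (fun kI => ψ N (kI b))‖ ≤ 4 * c ^ jDist j t b := by
    intro s₀ _
    refine (FiniteGibbs.norm_cavg_sub_cavg_le _ _ _).trans ?_
    have h1 := hcomp (fun s => (ψ N s).re) hosc_re s₀
    have h2 := hcomp (fun s => (ψ N s).im) hosc_im s₀
    rw [abs_sub_comm] at h1 h2
    linarith
  -- conditioning on `k_t`
  have hmain := FiniteGibbs.norm_cavg_mul_sub_le (fun kI => (hwpos kI).le) (FiniteGibbs.mass_pos_of_pos hwpos) t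
    (fun kI => ψ N (kI b)) (fun s => ψ N (-s)) (MG := 1) (fun s => (norm_ψ _).le) hB
  rw [cavg_ψ_eval_eq_zero hN, zero_mul, sub_zero, one_mul] at hmain
  have heq : (fun kI : Site d L → ZMod N => ψ N (kI b) * ψ N (-kI t)) = fun kI => ψ N (kI b - kI t) := by
    funext kI; rw [← ψ_add, sub_eq_add_neg]
  rw [heq] at hmain
  exact hmain

end ZN

end Summit.Ventures.YMGap.RobustBall

end
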